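import Summits.QuantumFields.YangMills.Theorems.BalabanUVNodesN16CaptureOfExists8Problem
import Summits.QuantumFields.YangMills.Theorems.BalabanUVNodesN19RateEdgeHolderD4AtBareLedgerReadingV
import HarnessLib

/-!
# Route «BalabanUVNodes» (K3⁸ `SpineGivenEndpointR13SepCoPHV`, stmt-QuantumFields-27366), DAG node N16 = NE3 — THE N16 → N19′ JUNCTION AT THE LIVE CONSUMER:
# dag-n19-w3's per-tuple rows `hH3` ∕ `hsel` of `…N19RateEdgeHolderD4AtBareLedgerReading(V)` PRODUCED from the loose pin, any loose leaf, Theorem 1's clause (8)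
# read at the problem level, and its uniqueness sentence for interior local minimisers (file 5 of width seat `pub-ymgap-dag-n16-w4`)

Cell `pub-ymgap`, width seat `pub-ymgap-dag-n16-w4` (director-ym R399 (3a) ∕ HUMAN RULING D-0149∕D-0154), generation 4, file 5 of the lineage — over this seat's files 3–4
(`BalabanUVNodesN16InteriorLeafOfLooseLeaf` p610667, `BalabanUVNodesN16CaptureOfExists8Problem` p617432 ∕ p619227).  Occasion: dag-n19-w3 g5's CLAIM-5 ∕ DECL-DELTA-5
(bus I.38805 ∕ I.38904): the (v′-16) RESIDUE of NODE O's reading — the leaf-(H3) sup row and the minimiser-selection rows — now stands OUTSIDE NODE O's `∃` as two per-tuple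
displayed rows `hH3`, `hsel` of `…N19RateEdgeHolderD4AtBareLedgerReading(V)`, typed in EXACTLY the currency this lineage's pin-level producers conclude.  This file applies
those producers: it delivers the two rows, at every tuple `(F, θ, hP, g₀, os, k)`, from node N16's displayed in-edges.
`--kind proof --supports stmt-QuantumFields-27366 --as helper` (count-neutral; KEY MAP v2: K3⁷ stmt-QuantumFields-20544 aside, lineage valid by the MIS-KEY rule).
`bears_on: R4∕N16 · junction N16 → N19′`.

THE ROWS (dag-n19-w3 (5b) :134–145, :267–277; `R := rateCarriersOfRecord₁₃CoPH 𝔯 F θ hP g₀ os k`):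
 * `hH3`:  `LeafH3sup 4 R.ne3.L R.ne3.Nper R.ne3.ε R.ne3.b (c' F) R.ne3.dom` — EVERY minimiser of every run over the closed plaquette class `sfClass R.ne3.ε` at a datum of
   `R.ne3.dom` is sup-regular with the INTERIOR value letter `R.ne3.b` and gradient letter `c' F`;
 * `hsel`: `∃ sel, (∀ V ∈ R.ne3.dom, ∀ j, IsMinimiser 4 (sfClass 4 R.ne3.L R.ne3.Nper R.ne3.ε) R.ne3.L R.ne3.Nper j V (sel j V)) ∧ (∀ V ∈ R.ne3.dom, ∀ j, RegularSup 4 R.ne3.L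
   R.ne3.Nper R.ne3.b (c' F) j (sel j V))` — a SELECTED minimiser of every run, sup-regular with the same letters.
Under K3's loose pin `N16PinnedLoose 𝔯 ℓ₃ B` (dag-n16-e module 43: `R.ne3` IS node N16's loose object of record — letters `F.L`, `ne3NperOfRecord₁₁ F 0 0`, `(ℓ₃ F).ε`,
`(ℓ₃ F).b`, data `{V ∈ ne3DomOfRecord₁₁ F N 0 0 | V ∈ sfClass 4 F.L Nper ((ℓ₃ F).ε ∕ B F) 0}` — `rateCarriers_ne3_of_pinnedLoose`, fields by `rfl`).

WHAT IS DISPLAYED INSTEAD (per family `F`; nothing asserted for any family):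
 * a LOOSE LEAF `LeafH3sup 4 F.L Nper (ρ F) (ρ F) (c F) D_F` at a radius `ρ F ≤ (ℓ₃ F).ε` on the pinned loose data `D_F` — VALUE LETTER = CLASS RADIUS, i.e.
   [Balaban1985Variational] Thm 1 (9)–(10) for the `ρ F`-minimisers in any typing; KEY-FREE (in-tree producer: dag-n16-w1 `…N16H7LooseOfReg910Slot.leafH3sup_loose_of_reg910Slot`,
   the slot key (T9ˢ)+(T8), at `ρ F := (C F).B₃·((ℓ₃ F).ε ∕ B F)`, `c F := 16937·ρ F`);
 * (P)-(8) at `(ρ F, εTop F)`, `εTop F ≥ (ℓ₃ F).ε`: at every datum of `D_F` and every run `k+1` a configuration of `sfClass (ρ F)` minimising over the BIG class `sfClass (εTop F)` —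
   [Balaban1985Variational] Thm 1 sentence 1 with clause (8) read at the PROBLEM level (p. 278 L34–37, p. 281 L24–26, p. 299 L22–39; [Balaban1987RGI] p. 256 L20–28; this seat's
   located note `LOCATED-N16-EXISTS8-PROBLEM-LEVEL.md`, evidence #59 on stmt-QuantumFields-20544) — node N07's theorem;
 * for `hH3` ONLY: Thm 1 sentence 2 at `ε₀ := εTop F` for INTERIOR LOCAL MINIMISERS (file 4 §2b's shape: every configuration of `sfClass (εTop F) ∩ {Ū = V}` lying in
   `sfClass ((ℓ₃ F).ε)` that locally minimises `A^{(k+1)}` on that constraint set is on the gauge orbit of any `ρ F`-minimiser at `V`) — node N07's theorem composed with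
   Fermat on the constraint manifold, WEAKER than sentence 2 as printed;
 * the scalar rows `ρ F ≤ (ℓ₃ F).b` (THE MATCH: capture radius below the interior value letter) and `c F ≤ c' F`; the datum-radius rows N19's `sel` construction needs
   (`(ℓ₃ F).ε ∕ B F ≤ (ℓ₃ F).ε ∧ ≤ 1∕4 ∧ ≤ (ℓ₃ F).b`, `4·((ℓ₃ F).ε ∕ B F) ≤ c' F`) are NOT displayed: §1 derives them from the bill's own `hmatch` ∕ `hradii` rows VERBATIM.
CONTENT: §1 `datumRadius_rows_of_match_radii`; §2 ★★ `hH3_of_pinnedLoose_of_loose_of_exists8P_locMin` + ★ `hsel_of_pinnedLoose_of_loose_of_exists8P` (the `sel` row is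
UNIQUENESS-FREE: (P)-(8) + the loose leaf, NO sentence 2 — the located note §2 (a)); §3 the CAPTURE road (file 3): `hH3_of_pinnedLoose_of_loose_of_capture` ∕
`hsel_of_pinnedLoose_of_loose_of_exists_of_capture` with CAPTURE((ℓ₃ F).ε → ρ F) displayed instead of (P)-(8) + sentence 2 (any producer of capture: files 1–2's (U6) roads,
file 4 §2, …); §4 ★★★ `keyedCoreEdgeHolderD4BFree_crOfRecord₁₃VAt_of_bareLedgerReadingV_of_pinnedLoose_of_loose_of_exists8P` = dag-n19-w3 (5b)'s bill with `hH3 hsel`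
REPLACED by §2's displayed rows (one application of their ★★★ theorem).  Each theorem of §2–§3 concludes dag-n19-w3's binder text LETTER FOR LETTER (with `MatA N = Matrix (Fin N) (Fin N) ℂ` reducible), so the consumer's
`keyedCoreEdgeHolderD4BFree_crOfRecord₁₃VAt_of_linkReadingAtBareLedgerReadingV_finiteVolumeRows … hH3 hsel …` is fed by `(hH3_of_… …) (hsel_of_… …)` — one application.

LOCATED (bus I.38960): the name dag-n19-w3 cites for the currency, p607700 §5 (`leafH3sup_rateCarriers_of_pinnedLoose_of_unique6` ∕ `sel_rateCarriers_of_pinnedLoose_of_unique6`),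
displays dag-n16-e module 45's `(hGm, hG, hM, hT)` Theorem-1-at-`torusVP` bundle, which is UNINHABITED at every rank (dag-n16-w2 p608145 `not_forall_thm1At_torusVP`, dag-n16-w5
p609621 ∕ p610394) — those two theorems are VACUOUS AS TYPED; the producers used here (p610667 §2, p617432 §3∕§3b) have the same conclusions and display the key-free loose leaf
instead of that bundle.

HONESTY ROWS.  (i) ACCOUNTING, not a discharge: the rows `hH3`∕`hsel` are REPLACED by node N07's two sentences ((P)-(8), sentence 2 in LocMin form) + the loose leaf ((9)–(10))
+ scalar rows; nothing of [Balaban1985Variational] is proved here.  (ii) (P) is a READING of clause (8) (located, page:line above); the dictionary of record reads (8) at the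
space level (leaf-06 D-s3-2) — under that reading the `sel` row still follows from CAPTURE (§3) but not from (8) alone (located note §3's certificate).  (iii) The slot-key
instantiation of `hloose` is NOT performed here (it adds the rows `(C F).B₃·((ℓ₃ F).ε ∕ B F) ≤ (ℓ₃ F).b`, `16937·ρ F ≤ c' F`, `ρ F ≤ 1∕28`, `ρ F ≤ (C F).B₃·(C F).a₁` of dag-n16-w1's
files 7∕9 and dag-n16-w1 g6's B₃-threshold notes p618486 ∕ p620319; one `fun F => leafH3sup_loose_of_reg910Slot …` at the call site).

HONEST FRAMING.  Nested-class ∕ value ∕ gauge-orbit bookkeeping over landed lemmas BY NAME; nothing of Bałaban asserted or refuted; no stub of K3⁸ v6 (`stub_rates13HV` ∕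
`stub_expansion13HV`) closed or claimed; N16 ∕ N19 ∕ N07 NOT discharged; count-neutral (typed 28∕28 · discharged 5∕27 · A 5∕28 unmoved); one finite four-torus at fixed `ε`,
Bałaban AS PRINTED — NOT ℝ⁴, NOT infinite volume, NOT OS, NOT a mass gap; the YM mass gap (Clay) is NOT proved by any of this — R4 closes the conditional finite-𝕋⁴ rung
`BalabanLadder.UV` only; no summit statement is proved by this seat.

References: [Balaban1985Variational] T. Bałaban, *The variational problem and background fields in renormalization group method for lattice gauge theories*, CMP **102** (1985)
277–309, Thm 1 p. 279, pp. 278, 281, 299; [Balaban1987RGI] CMP **109** (1987) pp. 256, 260.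
-/

set_option autoImplicit false

open scoped BigOperators Matrix Matrix.Norms.L2Operator
open NormedSpace

namespace Summit.QuantumFields.YangMills.BalabanUVNodes.N16ProducersAtBareLedgerReading

open Literature.MathematicalPhysics.QuantumFieldTheory.Balaban1983to89
open Literature.MathematicalPhysics.QuantumFieldTheory.Balaban1983to89.T4Continuum (T4Family ULoop)
open B7Prop1Explicit B7Prop2Explicit MatrixLog UnitaryModel
open T4AveragingDeficitWall hiding Site Plane Plaq Bond
open Summit.QuantumFields.BalabanUV.T4Continuum
open MinimalActionSandwich (IsMinimiser admissible)
open MinimalActionLevels (levelAction)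
open MinimalActionRate (sfClass)
open MinimalActionRefine (RegularSup gradConst)
open MinimalActionDictionary (sfClass_mono)
open NE3.LeafIndexSockets (LeafH3sup)
open NE3EnergyShapes (IsUnitarySite IsPeriodicSite)
open Node00 (Stage13HParams NE3Letters₁₁ ne3NperOfRecord₁₁ ne3DomOfRecord₁₁ MatA)
open YMDAG.UVSplit (RateReading₁₃CoPH rateCarriersOfRecord₁₃CoPH)
open Summit.QuantumFields.YangMills.BalabanUVNodes.N16InteriorOfCapture (isMinimiser_of_capture)
open Summit.QuantumFields.YangMills.BalabanUVNodes.N16InteriorLeafOfLooseLeaf (leafH3sup_rateCarriers_of_pinnedLoose_of_loose_of_capture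
  sel_rateCarriers_of_pinnedLoose_of_loose_of_capture)
open Summit.QuantumFields.YangMills.BalabanUVNodes.N16CaptureOfExists8Problem (capture_on_of_exists8P_of_unique6LocMin
  sel_rateCarriers_of_pinnedLoose_of_loose_of_exists8P)
open Summit.QuantumFields.YangMills.BalabanUVNodes.N16PinnedLayer13CoPH (N16PinnedLoose)
-- vocabulary of dag-n19-w3's (5b) `…N19RateEdgeHolderD4AtBareLedgerReadingV` (for §4's restated bill)
open Finset MeasureTheory
open T4OutputRate T4RecentScale T4GoodClassBudget T4CauchySum T4TowerRateComposition T4TowerRateDischarge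
open T4EtaRateMin (Readings NE3Shape)
open T4RateLiaison (GaugeDominated)
open FlowStep (RGEqH prefixOf)
open TreeLengthTorus (TFaceConnected torusTreeLen)
open B12TreeDecay (kappa₀)
open MinimalActionSandwich (minAct)
open Summit.QuantumFields.BalabanUV.T4Continuum.Spine
open Summit.QuantumFields.BalabanUV.T4Continuum.Spine.NE4 (runFlow)
open Summit.QuantumFields.YangMills.BalabanUVNodes.N19LedgerLinkSync (LedgerDataSync LedgerAtSync)
open YMDAG.UVSplit (SpineCarriers RateCarriers ReadOutAt Datum ShellSplit₁₃CoPH crOfRecord₁₃VAt)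
open Summit.QuantumFields.YangMills.BalabanUVNodes.SpineRatesHolder (RatesHolderAt)
open Node00 (datumOfRecord₁₃CoPH U3Letters₁₁)
open Summit.QuantumFields.YangMills.BalabanUVNodes.N16PinnedLayer13CoPH (N16LettersEnd)
open YMDAG.N14.TopBorn (Ne1PinnedOfRecord)
open Literature.MathematicalPhysics.QuantumFieldTheory.Balaban1983to89.Node00.U3OfKernels (objectsOfRecord₁₃)
open Literature.MathematicalPhysics.QuantumFieldTheory.Balaban1983to89.Node00.U3KernelLetters (WindowedNE9OfRecord₁₃ WindowedDecayOfRecord₁₃ GeometricIncrementsOfRecord₁₃)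
open T4ContinuumYM4Torus (ForSmallCouplings)
open Summit.QuantumFields.YangMills.BalabanUVNodes.N19RateEdgeHolderD4AtBareLedgerReadingV
  (keyedCoreEdgeHolderD4BFree_crOfRecord₁₃VAt_of_linkReadingAtBareLedgerReadingV_finiteVolumeRows)

noncomputable section

variable {N : ℕ} [NeZero N]

/-! ## §1 The datum-radius rows, from the bill's own `hmatch` ∕ `hradii` -/

/-- **THE DATUM-RADIUS ROWS ARE ALREADY ON THE BILL.**  dag-n19-w3's `hmatch` (`0 < B F ∧ (ℓ₃ F).ε ∕ B F ≤ (ℓ₃ F).b`) and `hradii` (…, `(ℓ₃ F).b ≤ c' F`, …,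
`2⁷⁶·L¹²·c' F ≤ (ℓ₃ F).ε`, `(ℓ₃ F).ε ∕ B F ≤ 1∕4`, `4·((ℓ₃ F).ε ∕ B F) ≤ c' F`), quoted VERBATIM, give the four rows the `sel` construction reads at the datum radius
`ε₁ := (ℓ₃ F).ε ∕ B F`: `ε₁ ≤ (ℓ₃ F).ε` (via `ε₁ ≤ b ≤ c' ≤ 2⁷⁶L¹²·c' ≤ ε`, `L ≥ 1`), `ε₁ ≤ 1∕4`, `ε₁ ≤ (ℓ₃ F).b`, `4ε₁ ≤ c' F`. [folklore] -/
theorem datumRadius_rows_of_match_radii {ℓ₃ : T4Family → NE3Letters₁₁} {B c' : T4Family → ℝ}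
    (hmatch : ∀ F : T4Family, 0 < B F ∧ (ℓ₃ F).ε / B F ≤ (ℓ₃ F).b)
    (hradii : ∀ F : T4Family, (ℓ₃ F).g = gradConst 4 (c' F) ∧ 0 ≤ c' F ∧ 0 < c' F ∧ (ℓ₃ F).b ≤ c' F ∧
      (2 : ℝ) ^ 91 * (F.L : ℝ) ^ 17 * c' F ≤ 1 ∧ (2 : ℝ) ^ 76 * (F.L : ℝ) ^ 12 * c' F ≤ (ℓ₃ F).ε ∧ (ℓ₃ F).ε / B F ≤ 1 / 4 ∧ 4 * ((ℓ₃ F).ε / B F) ≤ c' F)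
    (F : T4Family) :
    ((ℓ₃ F).ε / B F ≤ (ℓ₃ F).ε ∧ (ℓ₃ F).ε / B F ≤ 1 / 4 ∧ (ℓ₃ F).ε / B F ≤ (ℓ₃ F).b) ∧ 4 * ((ℓ₃ F).ε / B F) ≤ c' F := by
  obtain ⟨_, hεb⟩ := hmatch F
  obtain ⟨_, hc0, _, hbc, _, h76, h4, h4c⟩ := hradii F
  have hL : (1 : ℝ) ≤ (F.L : ℝ) := by exact_mod_cast F.hL.2.le
  have hL12 : (1 : ℝ) ≤ (F.L : ℝ) ^ 12 := one_le_pow₀ hL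
  have hc'ε : c' F ≤ (ℓ₃ F).ε := by
    have h1 : (1 : ℝ) ≤ (2 : ℝ) ^ 76 * (F.L : ℝ) ^ 12 := by nlinarith
    have h2 : 1 * c' F ≤ (2 : ℝ) ^ 76 * (F.L : ℝ) ^ 12 * c' F := mul_le_mul_of_nonneg_right h1 hc0
    linarith
  exact ⟨⟨hεb.trans (hbc.trans hc'ε), h4, hεb⟩, h4c⟩

/-! ## §2 The (P)-road: `hH3` from the loose leaf + (P)-(8)⋆ + sentence 2 for interior local minimisers; `hsel` from the loose leaf + (P)-(8) alone -/

/-- **★★ dag-n19-w3's ROW `hH3` AT EVERY TUPLE, FROM THE LOOSE PIN + ANY LOOSE LEAF + (P)-(8)⋆ + THEOREM 1 SENTENCE 2 FOR INTERIOR LOCAL MINIMISERS.**  Displayed per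
family `F`: the loose leaf at `ρ F ≤ (ℓ₃ F).ε` on the pinned loose data `D_F` ([Balaban1985Variational] Thm 1 (9)–(10), key-free); (P)-(8) at `(ρ F, εTop F)` on `D_F`,
`(ℓ₃ F).ε ≤ εTop F` (Thm 1 sentence 1, problem level); sentence 2 at `εTop F` for interior local minimisers (file 4 §2b's `hU6loc` shape); the match row `ρ F ≤ (ℓ₃ F).b` and
`c F ≤ c' F`.  Conclusion: the consumer's `hH3` binder text.  Proof: file 3's pin-level theorem with CAPTURE((ℓ₃ F).ε → ρ F) supplied by file 4's
`capture_on_of_exists8P_of_unique6LocMin`. [cite: Balaban1985Variational, Thm 1 (8)–(10) p.279] -/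
theorem hH3_of_pinnedLoose_of_loose_of_exists8P_locMin {𝔯 : RateReading₁₃CoPH N} {ℓ₃ : T4Family → NE3Letters₁₁} {B c' : T4Family → ℝ}
    (hpin : N16PinnedLoose 𝔯 ℓ₃ B) {ρ c εTop : T4Family → ℝ}
    (hloose : ∀ F : T4Family, LeafH3sup 4 F.L (ne3NperOfRecord₁₁ F 0 0) (ρ F) (ρ F) (c F)
      ({V | V ∈ ne3DomOfRecord₁₁ F N 0 0 ∧ V ∈ sfClass 4 F.L (ne3NperOfRecord₁₁ F 0 0) ((ℓ₃ F).ε / B F) 0} : Set (Site 4 → Fin 4 → (MatA N)ˣ)))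
    (hρε : ∀ F : T4Family, ρ F ≤ (ℓ₃ F).ε) (hεT : ∀ F : T4Family, (ℓ₃ F).ε ≤ εTop F)
    (h8P : ∀ (F : T4Family), ∀ V ∈ ({V | V ∈ ne3DomOfRecord₁₁ F N 0 0 ∧ V ∈ sfClass 4 F.L (ne3NperOfRecord₁₁ F 0 0) ((ℓ₃ F).ε / B F) 0} :
        Set (Site 4 → Fin 4 → (MatA N)ˣ)), ∀ k : ℕ, ∃ U₀ : Site 4 → Fin 4 → (MatA N)ˣ,
      U₀ ∈ sfClass 4 F.L (ne3NperOfRecord₁₁ F 0 0) (ρ F) (k + 1) ∧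
        IsMinimiser 4 (sfClass 4 F.L (ne3NperOfRecord₁₁ F 0 0) (εTop F)) F.L (ne3NperOfRecord₁₁ F 0 0) (k + 1) V U₀)
    (hU6loc : ∀ (F : T4Family) (k : ℕ), ∀ V ∈ ({V | V ∈ ne3DomOfRecord₁₁ F N 0 0 ∧ V ∈ sfClass 4 F.L (ne3NperOfRecord₁₁ F 0 0) ((ℓ₃ F).ε / B F) 0} :
        Set (Site 4 → Fin 4 → (MatA N)ˣ)),
      ∀ U₀ : Site 4 → Fin 4 → (MatA N)ˣ, IsMinimiser 4 (sfClass 4 F.L (ne3NperOfRecord₁₁ F 0 0) (ρ F)) F.L (ne3NperOfRecord₁₁ F 0 0) (k + 1) V U₀ →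
      ∀ U : Site 4 → Fin 4 → (MatA N)ˣ, U ∈ sfClass 4 F.L (ne3NperOfRecord₁₁ F 0 0) (εTop F) (k + 1) → avgIter F.L U (k + 1) = V →
        U ∈ sfClass 4 F.L (ne3NperOfRecord₁₁ F 0 0) (ℓ₃ F).ε (k + 1) →
        IsLocalMinOn (fun W : Site 4 → Fin 4 → (MatA N)ˣ => levelAction 4 F.L (ne3NperOfRecord₁₁ F 0 0) (k + 1) W)
          (admissible (sfClass 4 F.L (ne3NperOfRecord₁₁ F 0 0) (εTop F)) F.L (k + 1) V) U →
        ∃ u : Site 4 → (MatA N)ˣ, IsUnitarySite u ∧ IsPeriodicSite u ((ne3NperOfRecord₁₁ F 0 0 * F.L ^ (k + 1) : ℕ) : ℤ) ∧ gaugeAct u U₀ = U)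
    (hρb : ∀ F : T4Family, ρ F ≤ (ℓ₃ F).b) (hc : ∀ F : T4Family, c F ≤ c' F) :
    ∀ (F : T4Family) (θ : Stage13HParams F N) (hP : θ.Provisos₁₃CoPH F N) (g₀ : ℕ → ℝ) (os : List (ULoop F)) (k : ℕ),
      LeafH3sup 4 (rateCarriersOfRecord₁₃CoPH 𝔯 F θ hP g₀ os k).ne3.L (rateCarriersOfRecord₁₃CoPH 𝔯 F θ hP g₀ os k).ne3.Nper
        (rateCarriersOfRecord₁₃CoPH 𝔯 F θ hP g₀ os k).ne3.ε (rateCarriersOfRecord₁₃CoPH 𝔯 F θ hP g₀ os k).ne3.b (c' F)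
        (rateCarriersOfRecord₁₃CoPH 𝔯 F θ hP g₀ os k).ne3.dom :=
  fun F θ hP g₀ os k =>
    leafH3sup_rateCarriers_of_pinnedLoose_of_loose_of_capture hpin hloose hρε
      (fun F' => capture_on_of_exists8P_of_unique6LocMin (hεT F') (h8P F') (hU6loc F') (hρε F') le_rfl)
      F θ hP g₀ os k (hρb F) (hc F)

/-- **★ dag-n19-w3's ROW `hsel` AT EVERY TUPLE, UNIQUENESS-FREE: THE LOOSE PIN + ANY LOOSE LEAF + (P)-(8).**  Displayed per family `F`: the loose leaf at `ρ F ≤ (ℓ₃ F).ε`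
on `D_F`; (P)-(8) at `(ρ F, εTop F)` on `D_F` with `(ℓ₃ F).ε ≤ εTop F` (the problem's captured minimiser `U₀` IS the selection: it minimises over the intermediate class
`sfClass ((ℓ₃ F).ε)` — dag-n16-w1's `isMinimiser_of_capture` — and, being a `ρ F`-minimiser, is regular by the loose leaf); the match row `ρ F ≤ (ℓ₃ F).b`, `c F ≤ c' F`; and
the bill's `hmatch` ∕ `hradii` rows VERBATIM (§1 extracts the datum-radius rows).  NO uniqueness sentence, NO capture of the other minimisers.  Conclusion: the consumer's
`hsel` binder text. [cite: Balaban1985Variational, Thm 1 (8)–(10) p.279] -/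
theorem hsel_of_pinnedLoose_of_loose_of_exists8P {𝔯 : RateReading₁₃CoPH N} {ℓ₃ : T4Family → NE3Letters₁₁} {B c' : T4Family → ℝ}
    (hpin : N16PinnedLoose 𝔯 ℓ₃ B) {ρ c εTop : T4Family → ℝ}
    (hloose : ∀ F : T4Family, LeafH3sup 4 F.L (ne3NperOfRecord₁₁ F 0 0) (ρ F) (ρ F) (c F)
      ({V | V ∈ ne3DomOfRecord₁₁ F N 0 0 ∧ V ∈ sfClass 4 F.L (ne3NperOfRecord₁₁ F 0 0) ((ℓ₃ F).ε / B F) 0} : Set (Site 4 → Fin 4 → (MatA N)ˣ)))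
    (hρε : ∀ F : T4Family, ρ F ≤ (ℓ₃ F).ε) (hεT : ∀ F : T4Family, (ℓ₃ F).ε ≤ εTop F)
    (h8P : ∀ (F : T4Family), ∀ V ∈ ({V | V ∈ ne3DomOfRecord₁₁ F N 0 0 ∧ V ∈ sfClass 4 F.L (ne3NperOfRecord₁₁ F 0 0) ((ℓ₃ F).ε / B F) 0} :
        Set (Site 4 → Fin 4 → (MatA N)ˣ)), ∀ k : ℕ, ∃ U₀ : Site 4 → Fin 4 → (MatA N)ˣ,
      U₀ ∈ sfClass 4 F.L (ne3NperOfRecord₁₁ F 0 0) (ρ F) (k + 1) ∧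
        IsMinimiser 4 (sfClass 4 F.L (ne3NperOfRecord₁₁ F 0 0) (εTop F)) F.L (ne3NperOfRecord₁₁ F 0 0) (k + 1) V U₀)
    (hρb : ∀ F : T4Family, ρ F ≤ (ℓ₃ F).b) (hc : ∀ F : T4Family, c F ≤ c' F)
    (hmatch : ∀ F : T4Family, 0 < B F ∧ (ℓ₃ F).ε / B F ≤ (ℓ₃ F).b)
    (hradii : ∀ F : T4Family, (ℓ₃ F).g = gradConst 4 (c' F) ∧ 0 ≤ c' F ∧ 0 < c' F ∧ (ℓ₃ F).b ≤ c' F ∧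
      (2 : ℝ) ^ 91 * (F.L : ℝ) ^ 17 * c' F ≤ 1 ∧ (2 : ℝ) ^ 76 * (F.L : ℝ) ^ 12 * c' F ≤ (ℓ₃ F).ε ∧ (ℓ₃ F).ε / B F ≤ 1 / 4 ∧ 4 * ((ℓ₃ F).ε / B F) ≤ c' F) :
    ∀ (F : T4Family) (θ : Stage13HParams F N) (hP : θ.Provisos₁₃CoPH F N) (g₀ : ℕ → ℝ) (os : List (ULoop F)) (k : ℕ),
      ∃ sel : ℕ → (Site 4 → Fin 4 → (MatA N)ˣ) → (Site 4 → Fin 4 → (MatA N)ˣ),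
        (∀ V ∈ (rateCarriersOfRecord₁₃CoPH 𝔯 F θ hP g₀ os k).ne3.dom, ∀ j : ℕ,
          IsMinimiser 4 (sfClass 4 (rateCarriersOfRecord₁₃CoPH 𝔯 F θ hP g₀ os k).ne3.L (rateCarriersOfRecord₁₃CoPH 𝔯 F θ hP g₀ os k).ne3.Nper
            (rateCarriersOfRecord₁₃CoPH 𝔯 F θ hP g₀ os k).ne3.ε) (rateCarriersOfRecord₁₃CoPH 𝔯 F θ hP g₀ os k).ne3.L
            (rateCarriersOfRecord₁₃CoPH 𝔯 F θ hP g₀ os k).ne3.Nper j V (sel j V)) ∧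
        (∀ V ∈ (rateCarriersOfRecord₁₃CoPH 𝔯 F θ hP g₀ os k).ne3.dom, ∀ j : ℕ,
          RegularSup 4 (rateCarriersOfRecord₁₃CoPH 𝔯 F θ hP g₀ os k).ne3.L (rateCarriersOfRecord₁₃CoPH 𝔯 F θ hP g₀ os k).ne3.Nper
            (rateCarriersOfRecord₁₃CoPH 𝔯 F θ hP g₀ os k).ne3.b (c' F) j (sel j V)) := by
  intro F θ hP g₀ os k
  obtain ⟨_, hε₁c⟩ := datumRadius_rows_of_match_radii hmatch hradii F
  -- (P)-(8) at `(ρ F', εTop F')` gives (P)-(8) at `(ρ F', (ℓ₃ F').ε)`: the captured top minimiser minimises over the intermediate class it lies in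
  have h8P' : ∀ (F' : T4Family), ∀ V ∈ ({V | V ∈ ne3DomOfRecord₁₁ F' N 0 0 ∧ V ∈ sfClass 4 F'.L (ne3NperOfRecord₁₁ F' 0 0) ((ℓ₃ F').ε / B F') 0} :
      Set (Site 4 → Fin 4 → (MatA N)ˣ)), ∀ k : ℕ, ∃ U₀ : Site 4 → Fin 4 → (MatA N)ˣ,
      U₀ ∈ sfClass 4 F'.L (ne3NperOfRecord₁₁ F' 0 0) (ρ F') (k + 1) ∧
        IsMinimiser 4 (sfClass 4 F'.L (ne3NperOfRecord₁₁ F' 0 0) (ℓ₃ F').ε) F'.L (ne3NperOfRecord₁₁ F' 0 0) (k + 1) V U₀ := by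
    intro F' V hV k
    obtain ⟨U₀, hmem, hmin⟩ := h8P F' V hV k
    exact ⟨U₀, hmem, isMinimiser_of_capture (hεT F') hmin (sfClass_mono (hρε F') hmem)⟩
  exact sel_rateCarriers_of_pinnedLoose_of_loose_of_exists8P hpin hloose hρε h8P'
    (fun F' => (datumRadius_rows_of_match_radii hmatch hradii F').1) F θ hP g₀ os k (hρb F) (hc F) hε₁c

/-! ## §3 The CAPTURE road (file 3): `hH3` ∕ `hsel` with CAPTURE((ℓ₃ F).ε → ρ F) displayed instead of (P)-(8) and sentence 2 -/

/-- **dag-n19-w3's ROW `hH3` AT EVERY TUPLE FROM THE LOOSE PIN + ANY LOOSE LEAF + CAPTURE** — file 3's `leafH3sup_rateCarriers_of_pinnedLoose_of_loose_of_capture` with the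
gradient letter read per family (`c' F`).  Displayed per family: the loose leaf at `ρ F ≤ (ℓ₃ F).ε` on `D_F`, CAPTURE((ℓ₃ F).ε → ρ F) on `D_F` (every minimiser of every run
`k+1` over `sfClass ((ℓ₃ F).ε)` lies in `sfClass (ρ F)` — any producer: (U6) roads of files 1–2, (P)-road of file 4 §2), `ρ F ≤ (ℓ₃ F).b`, `c F ≤ c' F`.
[cite: Balaban1985Variational, Thm 1 (8)–(10) p.279] -/
theorem hH3_of_pinnedLoose_of_loose_of_capture {𝔯 : RateReading₁₃CoPH N} {ℓ₃ : T4Family → NE3Letters₁₁} {B c' : T4Family → ℝ}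
    (hpin : N16PinnedLoose 𝔯 ℓ₃ B) {ρ c : T4Family → ℝ}
    (hloose : ∀ F : T4Family, LeafH3sup 4 F.L (ne3NperOfRecord₁₁ F 0 0) (ρ F) (ρ F) (c F)
      ({V | V ∈ ne3DomOfRecord₁₁ F N 0 0 ∧ V ∈ sfClass 4 F.L (ne3NperOfRecord₁₁ F 0 0) ((ℓ₃ F).ε / B F) 0} : Set (Site 4 → Fin 4 → (MatA N)ˣ)))
    (hρε : ∀ F : T4Family, ρ F ≤ (ℓ₃ F).ε)
    (hcap : ∀ (F : T4Family), ∀ V ∈ ({V | V ∈ ne3DomOfRecord₁₁ F N 0 0 ∧ V ∈ sfClass 4 F.L (ne3NperOfRecord₁₁ F 0 0) ((ℓ₃ F).ε / B F) 0} :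
        Set (Site 4 → Fin 4 → (MatA N)ˣ)), ∀ (k : ℕ) (U : Site 4 → Fin 4 → (MatA N)ˣ),
      IsMinimiser 4 (sfClass 4 F.L (ne3NperOfRecord₁₁ F 0 0) (ℓ₃ F).ε) F.L (ne3NperOfRecord₁₁ F 0 0) (k + 1) V U →
        U ∈ sfClass 4 F.L (ne3NperOfRecord₁₁ F 0 0) (ρ F) (k + 1))
    (hρb : ∀ F : T4Family, ρ F ≤ (ℓ₃ F).b) (hc : ∀ F : T4Family, c F ≤ c' F) :
    ∀ (F : T4Family) (θ : Stage13HParams F N) (hP : θ.Provisos₁₃CoPH F N) (g₀ : ℕ → ℝ) (os : List (ULoop F)) (k : ℕ),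
      LeafH3sup 4 (rateCarriersOfRecord₁₃CoPH 𝔯 F θ hP g₀ os k).ne3.L (rateCarriersOfRecord₁₃CoPH 𝔯 F θ hP g₀ os k).ne3.Nper
        (rateCarriersOfRecord₁₃CoPH 𝔯 F θ hP g₀ os k).ne3.ε (rateCarriersOfRecord₁₃CoPH 𝔯 F θ hP g₀ os k).ne3.b (c' F)
        (rateCarriersOfRecord₁₃CoPH 𝔯 F θ hP g₀ os k).ne3.dom :=
  fun F θ hP g₀ os k => leafH3sup_rateCarriers_of_pinnedLoose_of_loose_of_capture hpin hloose hρε hcap F θ hP g₀ os k (hρb F) (hc F)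

/-- **dag-n19-w3's ROW `hsel` AT EVERY TUPLE FROM THE LOOSE PIN + ANY LOOSE LEAF + EXISTENCE + CAPTURE** — file 3's `sel_rateCarriers_of_pinnedLoose_of_loose_of_capture`
with the gradient letter per family and the datum-radius rows taken from the bill (§1).  Displayed per family: the loose leaf at `ρ F` on `D_F`, existence of minimisers of
every run `k+1` over `sfClass ((ℓ₃ F).ε)` at the data of `D_F` (the space-level reading (S) of clause (8) at the class radius, or compactness —
`Support/MinimalActionExistence`), CAPTURE((ℓ₃ F).ε → ρ F) on `D_F`, `ρ F ≤ (ℓ₃ F).b`, `c F ≤ c' F`, and the bill's `hmatch` ∕ `hradii`.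
[cite: Balaban1985Variational, Thm 1 (8)–(10) p.279] -/
theorem hsel_of_pinnedLoose_of_loose_of_exists_of_capture {𝔯 : RateReading₁₃CoPH N} {ℓ₃ : T4Family → NE3Letters₁₁} {B c' : T4Family → ℝ}
    (hpin : N16PinnedLoose 𝔯 ℓ₃ B) {ρ c : T4Family → ℝ}
    (hloose : ∀ F : T4Family, LeafH3sup 4 F.L (ne3NperOfRecord₁₁ F 0 0) (ρ F) (ρ F) (c F)
      ({V | V ∈ ne3DomOfRecord₁₁ F N 0 0 ∧ V ∈ sfClass 4 F.L (ne3NperOfRecord₁₁ F 0 0) ((ℓ₃ F).ε / B F) 0} : Set (Site 4 → Fin 4 → (MatA N)ˣ)))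
    (hρε : ∀ F : T4Family, ρ F ≤ (ℓ₃ F).ε)
    (hex : ∀ (F : T4Family), ∀ V ∈ ({V | V ∈ ne3DomOfRecord₁₁ F N 0 0 ∧ V ∈ sfClass 4 F.L (ne3NperOfRecord₁₁ F 0 0) ((ℓ₃ F).ε / B F) 0} :
        Set (Site 4 → Fin 4 → (MatA N)ˣ)), ∀ k : ℕ,
      ∃ U : Site 4 → Fin 4 → (MatA N)ˣ, IsMinimiser 4 (sfClass 4 F.L (ne3NperOfRecord₁₁ F 0 0) (ℓ₃ F).ε) F.L (ne3NperOfRecord₁₁ F 0 0) (k + 1) V U)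
    (hcap : ∀ (F : T4Family), ∀ V ∈ ({V | V ∈ ne3DomOfRecord₁₁ F N 0 0 ∧ V ∈ sfClass 4 F.L (ne3NperOfRecord₁₁ F 0 0) ((ℓ₃ F).ε / B F) 0} :
        Set (Site 4 → Fin 4 → (MatA N)ˣ)), ∀ (k : ℕ) (U : Site 4 → Fin 4 → (MatA N)ˣ),
      IsMinimiser 4 (sfClass 4 F.L (ne3NperOfRecord₁₁ F 0 0) (ℓ₃ F).ε) F.L (ne3NperOfRecord₁₁ F 0 0) (k + 1) V U →
        U ∈ sfClass 4 F.L (ne3NperOfRecord₁₁ F 0 0) (ρ F) (k + 1))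
    (hρb : ∀ F : T4Family, ρ F ≤ (ℓ₃ F).b) (hc : ∀ F : T4Family, c F ≤ c' F)
    (hmatch : ∀ F : T4Family, 0 < B F ∧ (ℓ₃ F).ε / B F ≤ (ℓ₃ F).b)
    (hradii : ∀ F : T4Family, (ℓ₃ F).g = gradConst 4 (c' F) ∧ 0 ≤ c' F ∧ 0 < c' F ∧ (ℓ₃ F).b ≤ c' F ∧
      (2 : ℝ) ^ 91 * (F.L : ℝ) ^ 17 * c' F ≤ 1 ∧ (2 : ℝ) ^ 76 * (F.L : ℝ) ^ 12 * c' F ≤ (ℓ₃ F).ε ∧ (ℓ₃ F).ε / B F ≤ 1 / 4 ∧ 4 * ((ℓ₃ F).ε / B F) ≤ c' F) :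
    ∀ (F : T4Family) (θ : Stage13HParams F N) (hP : θ.Provisos₁₃CoPH F N) (g₀ : ℕ → ℝ) (os : List (ULoop F)) (k : ℕ),
      ∃ sel : ℕ → (Site 4 → Fin 4 → (MatA N)ˣ) → (Site 4 → Fin 4 → (MatA N)ˣ),
        (∀ V ∈ (rateCarriersOfRecord₁₃CoPH 𝔯 F θ hP g₀ os k).ne3.dom, ∀ j : ℕ,
          IsMinimiser 4 (sfClass 4 (rateCarriersOfRecord₁₃CoPH 𝔯 F θ hP g₀ os k).ne3.L (rateCarriersOfRecord₁₃CoPH 𝔯 F θ hP g₀ os k).ne3.Nper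
            (rateCarriersOfRecord₁₃CoPH 𝔯 F θ hP g₀ os k).ne3.ε) (rateCarriersOfRecord₁₃CoPH 𝔯 F θ hP g₀ os k).ne3.L
            (rateCarriersOfRecord₁₃CoPH 𝔯 F θ hP g₀ os k).ne3.Nper j V (sel j V)) ∧
        (∀ V ∈ (rateCarriersOfRecord₁₃CoPH 𝔯 F θ hP g₀ os k).ne3.dom, ∀ j : ℕ,
          RegularSup 4 (rateCarriersOfRecord₁₃CoPH 𝔯 F θ hP g₀ os k).ne3.L (rateCarriersOfRecord₁₃CoPH 𝔯 F θ hP g₀ os k).ne3.Nper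
            (rateCarriersOfRecord₁₃CoPH 𝔯 F θ hP g₀ os k).ne3.b (c' F) j (sel j V)) := by
  intro F θ hP g₀ os k
  obtain ⟨_, hε₁c⟩ := datumRadius_rows_of_match_radii hmatch hradii F
  exact sel_rateCarriers_of_pinnedLoose_of_loose_of_capture hpin hloose hρε hex hcap
    (fun F' => (datumRadius_rows_of_match_radii hmatch hradii F').1) F θ hP g₀ os k (hρb F) (hc F) hε₁c

/-! ## §4 ★★★ The knit: dag-n19-w3's (5b) bill with `hH3 hsel` REPLACED by node N16's displayed in-edges (one application of their ★★★ theorem) -/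

/-- **★★★ THE N16 → N19′ JUNCTION KNIT AT THE LIVE WITNESS READING.**  dag-n19-w3 (5b)'s
`keyedCoreEdgeHolderD4BFree_crOfRecord₁₃VAt_of_linkReadingAtBareLedgerReadingV_finiteVolumeRows` — K3 «v6»'s (B)-free N19′ face, spelled, at the witness reading
`crOfRecord₁₃VAt K₀ (jc …) sh`, bare ledger reading, finite-volume currency — with its two per-tuple rows `hH3 hsel` (nodes N07 ∕ N16's minimiser rows) REPLACED by node
N16's displayed in-edges of §2: per family a loose leaf at `ρ F ≤ (ℓ₃ F).ε` on the pinned loose data (Thm 1 (9)–(10), key-free), (P)-(8) at `(ρ F, εTop F)` (Thm 1 sentence 1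
at the problem level), sentence 2 at `εTop F` for interior local minimisers, and the rows `ρ F ≤ (ℓ₃ F).b`, `c F ≤ c' F`.  EVERY OTHER BINDER IS (5b)'s, VERBATIM and in its
order (`hlinkBareV` = NODE O's bare ledger reading, ≈40 lines; the three pins; `hmatch hend`; stub 1's rows `hs hr hinc h9`; `hκ₀`; `hβw`; `hWall`; `hradii ∧ hclass`;
`2∕3 < β ≤ 1`), and so is the conclusion.  Proof: their theorem fed with `hH3_of_pinnedLoose_of_loose_of_exists8P_locMin` and `hsel_of_pinnedLoose_of_loose_of_exists8P`.
After this theorem the N19′-side bill's node-N07∕N16 CONTENT reads: the loose leaf + Thm 1 sentences 1–2 (LocMin form) + scalar rows — nothing else of N16.  ONE FACE-SHAPE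
modulo displayed hypotheses — NOT `stub_expansion13HV`, NOT K3⁸; N07 ∕ N16 ∕ N19 NOT discharged. [cite: Balaban1985Variational, Thm 1 (8)–(10) p.279] -/
theorem keyedCoreEdgeHolderD4BFree_crOfRecord₁₃VAt_of_bareLedgerReadingV_of_pinnedLoose_of_loose_of_exists8P
    (K₀ : ℕ)
    (jc : (F : T4Family) → (θ : Stage13HParams F N) → θ.Provisos₁₃CoPH F N → (ℕ → ℝ) → List (ULoop F) → ℕ → ℕ) (sh : ShellSplit₁₃CoPH N K₀)
    (𝔯 : RateReading₁₃CoPH N) (G : ∀ {F : T4Family}, Stage13HParams F N → Prop) {β : ℝ} (hβ1 : β ≤ 1)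
    {ℓ₃ : T4Family → NE3Letters₁₁} {g B c' : T4Family → ℝ}
    (hlinkBareV : ∀ (F : T4Family) (θ : Stage13HParams F N) (hP : θ.Provisos₁₃CoPH F N), G θ → θ.Admissible F N →
    ∀ (γ gIR b : ℝ) (g₀ : ℕ → ℝ), (datumOfRecord₁₃CoPH F N θ hP).Tuned γ gIR g₀ → γ ≤ θ.γ → γ ^ 2 ≤ Real.exp (-1) → 0 < b →
    (∀ K m, 0 ≤ m → m < K → b ≤ (datumOfRecord₁₃CoPH F N θ hP).βfun m (prefixOf (runFlow (datumOfRecord₁₃CoPH F N θ hP) g₀ K) m)) →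
    ∀ (os : List (ULoop F)) (k : ℕ),
      let S : SpineCarriers := crOfRecord₁₃VAt K₀ (jc F θ hP g₀ os) sh F θ hP g₀ os
      let R : RateCarriers N := rateCarriersOfRecord₁₃CoPH 𝔯 F θ hP g₀ os k
      let D : Datum F N := datumOfRecord₁₃CoPH F N θ hP
      letI := S.dec
      ∃ (_ : DecidableEq R.u3.C.Dom) (F' : Type) (ι' X' : Type) (_ : MeasurableSpace ι')
        (L : LedgerDataSync R.u3.C F' ι' S.ι) (Rd : Readings ι' X') (bsel : (ℕ → ℝ) → ℝ) (EB : Functional R.u3.C R.u3.C.BgB)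
        (g : ℕ → ℕ → ℝ)
        (uA : ℕ → ι' → R.u3.C.BgA) (uB : ℕ → ι' → R.u3.C.BgB)
        (Koff : ℕ) (cells : (K j : ℕ) → R.u3.C.Dom → Finset (Site (F.P (Koff + K)) j))
        (θ : ℝ)
        (rd : ι' → (B7Prop1Explicit.Site 4 → Fin 4 → (Matrix (Fin N) (Fin N) ℂ)ˣ)),
        (∀ K i, i ≤ K → g K i = runFlow D g₀ K i) ∧ (∀ K i, K < i → g K i = gIR) ∧
        EB = (fun s => R.u3.EB (bsel s) s) ∧
        (∀ (Sz : ℕ → ℝ → S.ι → ℕ → ℝ) (E₀ : ℝ) (m : ℕ) (a : ℝ) (Cw Λg : ℝ),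
          (∀ K t, |t| ≤ S.l₀ → ∀ τ ∈ S.T K \ S.Bad K t, ∀ v ∈ Rd.dom, ∀ j ≤ K,
            |∑ X ∈ L.fac K t τ with R.u3.C.scale X = j,
                (Real.log (Real.exp (EB (fun i => g (K + 1) (i + 1)) (uB K v) X
                    - EB (fun i => g (K + 1) (i + 1)) L.oneB X))
                  - Real.log (Real.exp (R.u3.EA (g K) (uA K v) X - R.u3.EA (g K) L.oneA X)))| ≤ Sz K t τ j) →
          0 ≤ E₀ → 0 < a → a < 1 →
          (∀ K t, |t| ≤ S.l₀ → ∀ τ ∈ S.T K \ S.Bad K t, ∀ j ≤ K,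
            Sz K t τ j ≤ S.vol * (E₀ * ((K : ℝ) + 1) ^ m * a ^ (K - j))) →
          (∀ K, Multiplicity (L.All K) R.u3.C.scale (fun X => Real.exp (-(R.u3.κ * R.u3.C.d X))) Cw S.vol Λg K) →
          (∀ K t, |t| ≤ S.l₀ → ∀ τ ∈ S.T K \ S.Bad K t,
            WindowMultiplicity (L.facO K t τ) L.scO L.wO Cw S.vol Λg (jlogOf L.Cl K) K) →
          1 ≤ Λg → L.θ' ≤ Λg →
          LedgerAtSync { L with S := Sz, E₀ := E₀, m := m, a := a, Cw := Cw, Λg := Λg } S.l₀ S.vol S.T S.Bad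
            (fun K t τ => S.A K t τ - S.shA K t τ) (fun K t τ => S.B K t τ - S.shB K t τ) Rd R.u3.EA EB R.u3.κ g uA uB
            R.u3.ω R.u3.ρ R.u3.θ (θ ^ ((3 : ℝ) * β - 2))) ∧
        (∀ K t, |t| ≤ S.l₀ → ∀ τ ∈ S.T K \ S.Bad K t,
          WindowMultiplicity (L.facO K t τ) L.scO L.wO L.Cw S.vol L.Λg (jlogOf L.Cl K) K) ∧
        0 ≤ L.Cw ∧ 1 ≤ L.Λg ∧ L.θ' ≤ L.Λg ∧
        (∀ K, ∀ X ∈ L.All K,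
          (cells K (R.u3.C.scale X + Koff) X).Nonempty ∧ TFaceConnected (cells K (R.u3.C.scale X + Koff) X)) ∧
        (∀ K j, Set.InjOn (cells K j) ↑((L.All K).filter fun X => R.u3.C.scale X + Koff = j)) ∧
        (∀ K, ∀ X ∈ L.All K, torusTreeLen (cells K (R.u3.C.scale X + Koff) X) ≤ R.u3.C.d X) ∧
        0 < θ ∧ θ ^ 6 = ((R.ne3.L : ℝ))⁻¹ ∧
        (∀ v ∈ Rd.dom, rd v ∈ R.ne3.dom) ∧
        (∀ k, ∀ v ∈ Rd.dom, Rd.act k v = minAct 4 (sfClass 4 R.ne3.L R.ne3.Nper R.ne3.ε) R.ne3.L R.ne3.Nper k (rd v)) ∧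
        (R.ne3.Nper : ℝ) ^ 4 ≤ Rd.vol ∧
        (∀ s ∈ Window γ, 0 < bsel s ∧ bsel s ≤ γ)) (hβ23 : 2 / 3 < β) (hpin1 : Ne1PinnedOfRecord 𝔯)
    (ℓ : (F : T4Family) → Stage13HParams F N → U3Letters₁₁)
    (hpinU3 : ∀ (F : T4Family) (θ : Stage13HParams F N) (hP : θ.Provisos₁₃CoPH F N) (g₀ : ℕ → ℝ) (os : List (ULoop F)),
      (𝔯.lit F θ hP g₀ os).u3 = objectsOfRecord₁₃ F N θ.toStage13Params (ℓ F θ))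
    (hκ₀ : ∀ (F : T4Family) (θ : Stage13HParams F N), θ.Provisos₁₃CoPH F N → G θ → θ.Admissible F N → kappa₀ (4 * 2 ^ 4) (2 * 4) ≤ (ℓ F θ).κ)
    (hpinL : N16PinnedLoose 𝔯 ℓ₃ B) (hmatch : ∀ F : T4Family, 0 < B F ∧ (ℓ₃ F).ε / B F ≤ (ℓ₃ F).b) (hend : N16LettersEnd N g ℓ₃)
    (hradii : ∀ F : T4Family, (ℓ₃ F).g = gradConst 4 (c' F) ∧ 0 ≤ c' F ∧ 0 < c' F ∧ (ℓ₃ F).b ≤ c' F ∧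
      (2 : ℝ) ^ 91 * (F.L : ℝ) ^ 17 * c' F ≤ 1 ∧ (2 : ℝ) ^ 76 * (F.L : ℝ) ^ 12 * c' F ≤ (ℓ₃ F).ε ∧ (ℓ₃ F).ε / B F ≤ 1 / 4 ∧ 4 * ((ℓ₃ F).ε / B F) ≤ c' F)
    (hclass : ∀ F : T4Family, 16 * B7Prop2Explicit.C0 4 * (ℓ₃ F).ε ≤ 3 ∧ 1024 * (4 + 1) * (4 + 4) * (F.L : ℝ) ^ 2 * (ℓ₃ F).ε ≤ 1)
    {ρ c εTop : T4Family → ℝ}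
    (hloose : ∀ F : T4Family, LeafH3sup 4 F.L (ne3NperOfRecord₁₁ F 0 0) (ρ F) (ρ F) (c F)
      ({V | V ∈ ne3DomOfRecord₁₁ F N 0 0 ∧ V ∈ sfClass 4 F.L (ne3NperOfRecord₁₁ F 0 0) ((ℓ₃ F).ε / B F) 0} : Set (Site 4 → Fin 4 → (MatA N)ˣ)))
    (hρε : ∀ F : T4Family, ρ F ≤ (ℓ₃ F).ε) (hεT : ∀ F : T4Family, (ℓ₃ F).ε ≤ εTop F)
    (h8P : ∀ (F : T4Family), ∀ V ∈ ({V | V ∈ ne3DomOfRecord₁₁ F N 0 0 ∧ V ∈ sfClass 4 F.L (ne3NperOfRecord₁₁ F 0 0) ((ℓ₃ F).ε / B F) 0} :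
        Set (Site 4 → Fin 4 → (MatA N)ˣ)), ∀ k : ℕ, ∃ U₀ : Site 4 → Fin 4 → (MatA N)ˣ,
      U₀ ∈ sfClass 4 F.L (ne3NperOfRecord₁₁ F 0 0) (ρ F) (k + 1) ∧
        IsMinimiser 4 (sfClass 4 F.L (ne3NperOfRecord₁₁ F 0 0) (εTop F)) F.L (ne3NperOfRecord₁₁ F 0 0) (k + 1) V U₀)
    (hU6loc : ∀ (F : T4Family) (k : ℕ), ∀ V ∈ ({V | V ∈ ne3DomOfRecord₁₁ F N 0 0 ∧ V ∈ sfClass 4 F.L (ne3NperOfRecord₁₁ F 0 0) ((ℓ₃ F).ε / B F) 0} :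
        Set (Site 4 → Fin 4 → (MatA N)ˣ)),
      ∀ U₀ : Site 4 → Fin 4 → (MatA N)ˣ, IsMinimiser 4 (sfClass 4 F.L (ne3NperOfRecord₁₁ F 0 0) (ρ F)) F.L (ne3NperOfRecord₁₁ F 0 0) (k + 1) V U₀ →
      ∀ U : Site 4 → Fin 4 → (MatA N)ˣ, U ∈ sfClass 4 F.L (ne3NperOfRecord₁₁ F 0 0) (εTop F) (k + 1) → avgIter F.L U (k + 1) = V →
        U ∈ sfClass 4 F.L (ne3NperOfRecord₁₁ F 0 0) (ℓ₃ F).ε (k + 1) →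
        IsLocalMinOn (fun W : Site 4 → Fin 4 → (MatA N)ˣ => levelAction 4 F.L (ne3NperOfRecord₁₁ F 0 0) (k + 1) W)
          (admissible (sfClass 4 F.L (ne3NperOfRecord₁₁ F 0 0) (εTop F)) F.L (k + 1) V) U →
        ∃ u : Site 4 → (MatA N)ˣ, IsUnitarySite u ∧ IsPeriodicSite u ((ne3NperOfRecord₁₁ F 0 0 * F.L ^ (k + 1) : ℕ) : ℤ) ∧ gaugeAct u U₀ = U)
    (hρb : ∀ F : T4Family, ρ F ≤ (ℓ₃ F).b) (hc : ∀ F : T4Family, c F ≤ c' F)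
    (hs : ∀ (F : T4Family) (θ : Stage13HParams F N), θ.Provisos₁₃CoPH F N → G θ → θ.Admissible F N → (ℓ F θ).Signs)
    (r : (F : T4Family) → Stage13HParams F N → ℝ)
    (hr : ∀ (F : T4Family) (θ : Stage13HParams F N), θ.Provisos₁₃CoPH F N → G θ → θ.Admissible F N → r F θ < 1)
    (hinc : ∀ (F : T4Family) (θ : Stage13HParams F N), θ.Provisos₁₃CoPH F N → G θ → θ.Admissible F N →
      GeometricIncrementsOfRecord₁₃ F N θ.toStage13Params (r F θ))
    (h9 : ∀ (F : T4Family) (θ : Stage13HParams F N), θ.Provisos₁₃CoPH F N → G θ → θ.Admissible F N →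
      WindowedNE9OfRecord₁₃ F N θ.toStage13Params (ℓ F θ).κ (ℓ F θ).moduli)
    (hWall : ∀ (μ ν : Fin 4) (F : T4Family) (θ : Stage13HParams F N), θ.Provisos₁₃CoPH F N → G θ → θ.Admissible F N →
      WindowedDecayOfRecord₁₃ F N θ.toStage13Params μ ν (ℓ F θ).κ)
    (ks : (F : T4Family) → (θ : Stage13HParams F N) → θ.Provisos₁₃CoPH F N → (ℕ → ℝ) → List (ULoop F) → ℕ)
    (hβw : ∀ (F : T4Family) (θ : Stage13HParams F N) (hP : θ.Provisos₁₃CoPH F N), G θ → θ.Admissible F N →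
      ∃ γ₀ b b' : ℝ, 0 < γ₀ ∧ 0 < b ∧ DagBinding.BetaBoundsInInterval (datumOfRecord₁₃CoPH F N θ hP).C.toB12 γ₀ b b') :
    ∀ (F : T4Family) (θ : Stage13HParams F N) (hP : θ.Provisos₁₃CoPH F N), G θ → θ.Admissible F N →
      ForSmallCouplings (datumOfRecord₁₃CoPH F N θ hP) fun g₀ => ∀ os : List (ULoop F),
        (RatesHolderAt (datumOfRecord₁₃CoPH F N θ hP) (rateCarriersOfRecord₁₃CoPH 𝔯 F θ hP g₀ os (ks F θ hP g₀ os)) β ∧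
          ReadOutAt (datumOfRecord₁₃CoPH F N θ hP) (rateCarriersOfRecord₁₃CoPH 𝔯 F θ hP g₀ os (ks F θ hP g₀ os)).u3 ∧
          (0 ≤ (rateCarriersOfRecord₁₃CoPH 𝔯 F θ hP g₀ os (ks F θ hP g₀ os)).u3.ρ ∧ (rateCarriersOfRecord₁₃CoPH 𝔯 F θ hP g₀ os (ks F θ hP g₀ os)).u3.ρ < 1)) →
        letI := (crOfRecord₁₃VAt K₀ (jc F θ hP g₀ os) sh F θ hP g₀ os).dec
        ∃ δ : ℕ → ℝ, NE7.Core (crOfRecord₁₃VAt K₀ (jc F θ hP g₀ os) sh F θ hP g₀ os).l₀ (crOfRecord₁₃VAt K₀ (jc F θ hP g₀ os) sh F θ hP g₀ os).vol (crOfRecord₁₃VAt K₀ (jc F θ hP g₀ os) sh F θ hP g₀ os).T (crOfRecord₁₃VAt K₀ (jc F θ hP g₀ os) sh F θ hP g₀ os).Bad (fun K t τ => (crOfRecord₁₃VAt K₀ (jc F θ hP g₀ os) sh F θ hP g₀ os).A K t τ - (crOfRecord₁₃VAt K₀ (jc F θ hP g₀ os) sh F θ hP g₀ os).shA K t τ)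 (fun K t τ => (crOfRecord₁₃VAt K₀ (jc F θ hP g₀ os) sh F θ hP g₀ os).B K t τ - (crOfRecord₁₃VAt K₀ (jc F θ hP g₀ os) sh F θ hP g₀ os).shB K t τ) δ ∧ Summable δ :=
  keyedCoreEdgeHolderD4BFree_crOfRecord₁₃VAt_of_linkReadingAtBareLedgerReadingV_finiteVolumeRows K₀ jc sh 𝔯 G hβ1 hlinkBareV hβ23 hpin1 ℓ hpinU3 hκ₀ hpinL
    hmatch hend hradii hclass
    (hH3_of_pinnedLoose_of_loose_of_exists8P_locMin hpinL hloose hρε hεT h8P hU6loc hρb hc)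
    (hsel_of_pinnedLoose_of_loose_of_exists8P hpinL hloose hρε hεT h8P hρb hc hmatch hradii) hs r hr hinc h9 hWall ks hβw

end

end Summit.QuantumFields.YangMills.BalabanUVNodes.N16ProducersAtBareLedgerReading
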